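import Literature.Probability.Divergences.RenyiDivergence
import Mathlib.MeasureTheory.Integral.MeanInequalities
import HarnessLib

/-!
# Bounds on the Hellinger integral of order `a < 1`

Topic `Literature/Probability/Divergences`; companion of `RenyiDivergence.lean` (definition item
`defn-fDiv` follow-up). For a simple order `0 < a < 1` the Hellinger integral
`hellingerIntegral a μ ν = ∫ (dμ/dν)^a dν = ∫ p^a q^{1-a} dλ` ([VanervenHarremoes2014, Def. 2])
satisfies, by Hölder's inequality with exponents `1/a` and `1/(1-a)`,
`∫ p^a q^{1-a} ≤ μ(univ)^a · ν(univ)^(1-a)` — hence `≤ 1` for probability measures, which is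
what makes `renyiDiv a μ ν = (a - 1)⁻¹ log ∫ p^a q^{1-a}` nonnegative ([VanervenHarremoes2014,
Thm. 8]) — and it vanishes exactly when `μ ⟂ ν` ([VanervenHarremoes2014, Thm. 24], the case
`D_a = ∞` for `a < 1`). All statements proved; no definitions, no facts.
-/

noncomputable section

open _root_.MeasureTheory Set
open scoped ENNReal

namespace Literature.Probability.Divergences

variable {α : Type*} [MeasurableSpace α]

/-- **Hölder bound on the Hellinger integral**, `0 < a < 1`:
`∫ p^a q^{1-a} ≤ μ(univ)^a · ν(univ)^(1-a)`; in particular `≤ 1` for probability measures (the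
Jensen/Hölder step in the source's proof of positivity of Rényi divergence, here for arbitrary
measures with a Lebesgue decomposition). [cite: VanervenHarremoes2014, Thm. 8 (proof)] -/
theorem hellingerIntegral_le_of_lt_one {a : ℝ} (ha0 : 0 < a) (ha : a < 1) (μ ν : Measure α)
    [μ.HaveLebesgueDecomposition ν] :
    hellingerIntegral a μ ν ≤ μ univ ^ a * ν univ ^ (1 - a) := by
  have hpq : Real.HolderConjugate a⁻¹ (1 - a)⁻¹ :=
    ⟨by rw [inv_inv, inv_inv, inv_one]; ring, inv_pos.mpr ha0, inv_pos.mpr (sub_pos.mpr ha)⟩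
  have hr : AEMeasurable (fun x => μ.rnDeriv ν x ^ a) ν :=
    ((Measure.measurable_rnDeriv μ ν).pow_const a).aemeasurable
  have h := ENNReal.lintegral_mul_le_Lp_mul_Lq ν hpq hr (aemeasurable_const (b := (1 : ℝ≥0∞)))
  simp only [Pi.mul_apply, mul_one, one_div, inv_inv, ENNReal.one_rpow, lintegral_const,
    one_mul] at h
  have hpow : ∫⁻ x, (μ.rnDeriv ν x ^ a) ^ a⁻¹ ∂ν = ∫⁻ x, μ.rnDeriv ν x ∂ν := by
    refine lintegral_congr fun x => ?_
    rw [← ENNReal.rpow_mul, mul_inv_cancel₀ ha0.ne', ENNReal.rpow_one]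
  rw [hpow] at h
  rw [hellingerIntegral_of_lt_one ha]
  calc ∫⁻ x, μ.rnDeriv ν x ^ a ∂ν ≤ (∫⁻ x, μ.rnDeriv ν x ∂ν) ^ a * ν univ ^ (1 - a) := h
    _ ≤ μ univ ^ a * ν univ ^ (1 - a) := by
        gcongr
        exact Measure.lintegral_rnDeriv_le

/-- For probability measures and `0 < a < 1` the Hellinger integral is at most `1`, i.e.
`D_a(μ ‖ ν) = (a-1)⁻¹ log ∫ p^a q^{1-a} ≥ 0` (positivity of Rényi divergence of order `a < 1`).
[cite: VanervenHarremoes2014, Thm. 8 (Positivity)] -/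
theorem hellingerIntegral_le_one {a : ℝ} (ha0 : 0 < a) (ha : a < 1) (μ ν : Measure α)
    [IsProbabilityMeasure μ] [IsProbabilityMeasure ν] : hellingerIntegral a μ ν ≤ 1 := by
  simpa using hellingerIntegral_le_of_lt_one ha0 ha μ ν

/-- For `0 < a < 1` the Hellinger integral vanishes exactly when the measures are mutually
singular (equivalently `D_a(μ ‖ ν) = ∞`; the source's `P ⟂ Q ⇔ ∫ p^a q^{1-a} dμ = 0`, after
Shiryaev). [cite: VanervenHarremoes2014, Thm. 24] -/
theorem hellingerIntegral_eq_zero_iff {a : ℝ} (ha0 : 0 < a) (ha : a < 1) (μ ν : Measure α)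
    [μ.HaveLebesgueDecomposition ν] : hellingerIntegral a μ ν = 0 ↔ μ ⟂ₘ ν := by
  rw [hellingerIntegral_of_lt_one ha,
    lintegral_eq_zero_iff ((Measure.measurable_rnDeriv μ ν).pow_const a),
    ← Measure.rnDeriv_eq_zero]
  refine ⟨fun h => ?_, fun h => ?_⟩
  · filter_upwards [h] with x hx
    simpa [ENNReal.rpow_eq_zero_iff_of_pos ha0] using hx
  · filter_upwards [h] with x hx
    simp [hx, ENNReal.zero_rpow_of_pos ha0]

end Literature.Probability.Divergences
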